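import Literature.Computability.Cryptography.RegevMainTheoremLoop
import Literature.Computability.Cryptography.StatisticalDistanceMixtures
import Literature.Computability.Cryptography.LWESampling
import HarnessLib

/-!
# Regev 2009, Theorem 3.1 in machine form, III: the stage family from the KERNEL laws of its stages

Topic `Computability/Cryptography` (family `pqc`), sequel of `RegevMainTheoremStages.lean` and
`RegevMainTheoremLoop.lean`. There pqc.S19 (SIVP form, `regev_lwe_to_sivp_quantum`) was reduced to the
single hypothesis `hStage` (`regev_lwe_to_sivp_quantum_of_stage`): ONE uniform quantum family `S` whose
stages, composed in a chain (`chainLaw`: run a stage, measure, hand a window of the register to the next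
stage), keep the law of the batch of lattice vectors read off the front of the register close to the
ideal batch `D_{L,ρ_k}^{⊗N}` — a statement about the CHAIN (its `k`-th clause compares `chainLaw (k+2)`
with `chainLaw (k+1)`).

This file carries out the probability step of Regev's proof of Theorem 3.1 that separates the chain
from the single stage (author's version arXiv:2401.03703, p. 15: "The procedure IterativeStep … by
applying it `n^c` times we obtain `n^c` samples"; Lemma 3.3 and the note after it: "the output
distribution is taken with respect to the randomness (and quantum measurements) used in the algorithm,
and not with respect to the input samples"; Lemma 3.4: the classical part solves `CVP` "given `n^c`
samples from `D_{L,r}`", i.e. for samples that are good on average). It reduces `hStage` to hypotheses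
on the KERNEL of `S` at one stage input `⟨x, ⟨1ᵏ, y⟩⟩` (`QuantumComplexity.stageInput x k y`), for the
previous windows `y` that are possible outputs of the previous stage only (the support of the chain):

* (FAC) for `k ≥ 1` the law of the decoded output batch depends on `y` only through the integer batch
  `readB y` read off its front by a total classical reader (`readB (encB b ++ w) = b`, and the junk
  batch `0` when no batch code is in front of `y`);
* (BOOT, Lemma 3.2 in machine form) at stage `0` the decoded batch is `ν_S`-close to `D_{L,ρ₀}^{⊗N}` when
  `ρ₀ > 2^{2n} λₙ(L)`;
* (STEP, Lemma 3.3 in machine form) at a quantum stage `k + 1 ≤ 3n` with `ρ_k > √2 q η_ε(L)`, GIVEN the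
  previous window `y`, the decoded output batch is `F(readB y)`-close to `D_{L,ρ_{k+1}}^{⊗N}` for a
  failure bound `F ≥ 0` with `E_{b ∼ D_{L,ρ_k}^{⊗N}}[min 1 F(b)] ≤ ν_S` (expectation over INTEGER batches,
  `Regev2009.idealBatchZ`);
* (PASS) at a padding stage `k + 1 > 3n` the batch read off `y` is written back exactly.

Proved here (no named fact is introduced; the kernel-level hypotheses are binders):

* generic one-step bounds for the law of a decoded register along a Markov chain of registers:
  `PMF.tvDist_map_bind_le_of_factor` — if `(K y).map read = κ (read y)` on the support of `μ`, then
  `Δ((μ ≫= K).map read, ι') ≤ Δ(μ.map read, ι) + E_{o ∼ ι} Δ(κ o, ι')` (kernel contraction through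
  `ι ≫= κ`, Goldreich 2001, §3.2); `PMF.tvDist_map_bind_le_of_pure` — stages that write back a
  function `φ` of what they read, with `ι.map φ = ι`, do not increase the distance to `ι`;
  `PMF.bind_congr_support`, `PMF.tsum_toReal_map_mul_of_injective`
  (expectations along an injective push-forward);
* the integer coordinates of the vectors of an integer lattice (`LatticeInstance.intCoords`,
  `intVecToEuclidean_intCoords`), the ideal batch as a law on integer batches (`Regev2009.idealBatchZ`,
  `idealBatch_eq_map_idealBatchZ`), `batchToE_injective`;
* **`Regev2009.thm_3_1_stage_of_kernelLaws`** — the kernel-level hypotheses imply `hStage` verbatim;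
  hence **`Regev2009.thm_3_1_machine_of_kernelLaws`** (Theorem 3.1 in machine form, `h₂`) and
  **`regev_lwe_to_sivp_quantum_of_kernelLaws : … → regev_lwe_to_sivp_quantum q α m`** (pqc.S19, SIVP
  form; the GapSVP form follows in the same way from `regev_lwe_to_gapSVP_quantum_of_stage_of_lemma320`).

What remains of pqc.S19 (SIVP) after this file: one uniform family `S` with the four KERNEL properties —
to be assembled (sequel) from a one-sample stage machine run in `N` parallel indexed copies
(`PolyCopiesIdx`) inside a classical wrap (`CWrap`) that canonicalises the input batch and collects the
output codes; the one-sample machine being Regev's bootstrap sampler (Lemma 3.2), quantum step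
(Lemmas 3.4 + 3.14) and the identity, dispatched on `k`.

## References

* O. Regev, *On lattices, learning with errors, random linear codes, and cryptography*, J. ACM 56
  (2009), art. 34; author's version arXiv:2401.03703: Theorem 3.1 and its proof (p. 15), Lemmas 3.2,
  3.3 (with the note following it), 3.4 [Regev2009].
* O. Goldreich, *Foundations of Cryptography* I, CUP 2001, §3.2.1–3.2.3 (statistical distance under
  randomised maps; hybrid arguments) [Goldreich2001].
* D. Micciancio, S. Goldwasser, *Complexity of Lattice Problems*, Kluwer 2002, Ch. 1 §1 (integer
  lattices) [MicciancioGoldwasser2002].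
-/

noncomputable section

open scoped ENNReal

/-! ### Generic probability: one step of a chain of registers -/

namespace PMF

variable {α β : Type*}

/-- Kernels that agree on the support of the prior give the same mixture. [folklore] -/
theorem bind_congr_support (μ : PMF α) {f g : α → PMF β} (h : ∀ a ∈ μ.support, f a = g a) :
    μ.bind f = μ.bind g := by
  refine PMF.ext fun b => ?_
  rw [PMF.bind_apply, PMF.bind_apply]
  refine tsum_congr fun a => ?_
  by_cases ha : a ∈ μ.support
  · rw [h a ha]
  · rw [(PMF.apply_eq_zero_iff μ a).2 ha, zero_mul, zero_mul]

/-- The push-forward along `f` vanishes off the range of `f`. [folklore] -/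
theorem map_apply_eq_zero_of_not_mem_range (p : PMF α) (f : α → β) {b : β} (hb : b ∉ Set.range f) :
    p.map f b = 0 := by
  rw [PMF.map_apply]
  exact ENNReal.tsum_eq_zero.2 fun a => if_neg fun e => hb ⟨a, e.symm⟩

/-- **Expectations along an injective push-forward**: `E_{p.map f}[g] = E_p[g ∘ f]` for injective `f`
(small types, as `LWE.pmf_map_apply_of_injective`). [folklore] -/
theorem tsum_toReal_map_mul_of_injective {α β : Type} (p : PMF α) {f : α → β} (hf : Function.Injective f)
    (g : β → ℝ) :
    ∑' b, (p.map f b).toReal * g b = ∑' a, (p a).toReal * g (f a) := by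
  have hsupp : Function.support (fun b => (p.map f b).toReal * g b) ⊆ Set.range f := by
    intro b hb
    by_contra hnot
    refine hb ?_
    show (p.map f b).toReal * g b = 0
    rw [map_apply_eq_zero_of_not_mem_range p f hnot, ENNReal.toReal_zero, zero_mul]
  rw [← hf.tsum_eq hsupp]
  exact tsum_congr fun a => by rw [Literature.Computability.Cryptography.LWE.pmf_map_apply_of_injective p hf]

variable {Y O : Type*}

/-- **One stage of a chain of registers, contraction form.** If the law of the decoded output of the
stage kernel `K` depends on the input register only through its decoding, `(K y).map read = κ (read y)`
on the support of the current law `μ`, then the decoded law after the stage is within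
`Δ(μ.map read, ι) + E_{o ∼ ι}[Δ(κ o, ι')]` of any target `ι'`, for any reference law `ι` of the current
decoding: `(μ ≫= K).map read = (μ.map read) ≫= κ`, then the triangle inequality through `ι ≫= κ`, kernel
contraction (`tvDist_bind_left_le`) and convexity (`tvDist_bind_right_right_le`).
[cite: Goldreich2001, §3.2.1–3.2.2 (statistical distance under randomised maps)] -/
theorem tvDist_map_bind_le_of_factor (μ : PMF Y) (K : Y → PMF Y) (read : Y → O) (κ : O → PMF O)
    (hκ : ∀ y ∈ μ.support, (K y).map read = κ (read y)) (ι ι' : PMF O) :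
    ((μ.bind K).map read).tvDist ι' ≤ (μ.map read).tvDist ι + ∑' o, (ι o).toReal * (κ o).tvDist ι' := by
  have hfac : (μ.bind K).map read = (μ.map read).bind κ := by
    rw [PMF.map_bind, PMF.bind_map]
    exact bind_congr_support μ fun y hy => hκ y hy
  rw [hfac]
  calc ((μ.map read).bind κ).tvDist ι'
      ≤ ((μ.map read).bind κ).tvDist (ι.bind κ) + (ι.bind κ).tvDist ι' := tvDist_triangle_holds _ _ _
    _ ≤ (μ.map read).tvDist ι + ∑' o, (ι o).toReal * (κ o).tvDist ι' := by
        refine add_le_add (tvDist_bind_left_le _ _ _) ?_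
        calc (ι.bind κ).tvDist ι' = (ι.bind κ).tvDist (ι.bind fun _ => ι') := by rw [PMF.bind_const]
          _ ≤ ∑' o, (ι o).toReal * (κ o).tvDist ι' := tvDist_bind_right_right_le ι κ fun _ => ι'

/-- **Stages that write back what they read** do not increase the distance to a law invariant under the
write-back map: if `(K y).map read = pure (φ (read y))` on the support of `μ` and `ι.map φ = ι`, then
`Δ((μ ≫= K).map read, ι) ≤ Δ(μ.map read, ι)` (data processing for `φ`).
[cite: Goldreich2001, §3.2.1 (Exercise 10 of Ch. 3: functions do not increase the distance)] -/
theorem tvDist_map_bind_le_of_pure (μ : PMF Y) (K : Y → PMF Y) (read : Y → O) (φ : O → O)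
    (hK : ∀ y ∈ μ.support, (K y).map read = PMF.pure (φ (read y))) (ι : PMF O) (hι : ι.map φ = ι) :
    ((μ.bind K).map read).tvDist ι ≤ (μ.map read).tvDist ι := by
  have hfac : (μ.bind K).map read = (μ.map read).map φ := by
    rw [PMF.map_bind, PMF.map_comp, bind_congr_support μ fun y hy => hK y hy]
    rfl
  calc ((μ.bind K).map read).tvDist ι = ((μ.map read).map φ).tvDist (ι.map φ) := by rw [hfac, hι]
    _ ≤ (μ.map read).tvDist ι := tvDist_map_le_holds _ _ _

end PMF

/-! ### Integer coordinates of the vectors of an integer lattice -/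

namespace Literature.Algebra.EuclideanLattices.LatticeInstance

/-- **The integer coordinates of a vector of `L(B)`**, `B ∈ ℤⁿˣⁿ` (`L(B) ⊆ ℤⁿ`,
`lattice_le_stdIntLattice`). [cite: MicciancioGoldwasser2002, Ch. 1 §1 (integer lattices)] -/
def intCoords (I : LatticeInstance) (v : I.lattice) : Fin I.n → ℤ :=
  fun j => Classical.choose ((mem_stdIntLattice_iff _).1 (I.lattice_le_stdIntLattice v.2) j)

/-- The defining property of the integer coordinates. [folklore] -/
theorem cast_intCoords (I : LatticeInstance) (v : I.lattice) (j : Fin I.n) :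
    ((I.intCoords v j : ℤ) : ℝ) = (v : EuclideanSpace ℝ (Fin I.n)) j :=
  Classical.choose_spec ((mem_stdIntLattice_iff _).1 (I.lattice_le_stdIntLattice v.2) j)

/-- **A lattice vector is the integer vector of its coordinates.** [cite: MicciancioGoldwasser2002, Ch. 1 §1] -/
theorem intVecToEuclidean_intCoords (I : LatticeInstance) (v : I.lattice) :
    intVecToEuclidean I.n (I.intCoords v) = v := by
  ext j
  rw [intVecToEuclidean_apply, cast_intCoords]

/-- Integer coordinates are injective. [folklore] -/
theorem intCoords_injective (I : LatticeInstance) : Function.Injective I.intCoords := fun v w h =>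
  Subtype.ext (by rw [← intVecToEuclidean_intCoords I v, ← intVecToEuclidean_intCoords I w, h])

end Literature.Algebra.EuclideanLattices.LatticeInstance

open Filter Literature.Computability.Complexity Literature.Computability.Cryptography.LWE
  Literature.Algebra.EuclideanLattices Literature.Computability.QuantumComplexity

namespace Literature.Computability.Cryptography

namespace Regev2009

/-! ### The ideal batch as a law on integer batches -/

/-- `batchToE` is injective. [folklore] -/
theorem batchToE_injective (n N : ℕ) : Function.Injective (batchToE n N) := fun _ _ h =>
  funext fun j => intVecToEuclidean_injective n (congrFun h j)

/-- **The ideal law of a stage's batch on INTEGER batches**: `N` independent samples of `D_{L(B),ρ}` in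
integer coordinates. [cite: Regev2009, Theorem 3.1 (proof: "n^c samples from D_{L,rᵢ}")] -/
def idealBatchZ (I : LatticeInstance) (N : ℕ) (ρ : ℝ) : PMF (Fin N → Fin I.n → ℤ) :=
  iidPMF ((discreteGaussian I.lattice ρ 0).map I.intCoords) N

/-- `idealBatchZ` as the push-forward of the `N` lattice samples. [folklore] -/
theorem idealBatchZ_eq_map (I : LatticeInstance) (N : ℕ) (ρ : ℝ) :
    idealBatchZ I N ρ = (iidPMF (discreteGaussian I.lattice ρ 0) N).map fun w => I.intCoords ∘ w :=
  (iidPMF_map_comp _ _ _).symm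

/-- **The ideal batch is the ideal integer batch, embedded and tagged**:
`idealBatch I N ρ = (idealBatchZ I N ρ).map (some ∘ batchToE)`. [folklore] -/
theorem idealBatch_eq_map_idealBatchZ (I : LatticeInstance) (N : ℕ) (ρ : ℝ) :
    idealBatch I N ρ = (idealBatchZ I N ρ).map fun b => some (batchToE I.n N b) := by
  rw [idealBatch, idealBatchZ, ← iidPMF_map_comp, ← iidPMF_map_comp, PMF.map_comp, PMF.map_comp]
  refine congrArg (PMF.map · _) (funext fun w => ?_)
  simp only [Function.comp_apply, Option.some.injEq]
  funext j
  simp only [batchToE, Function.comp_apply, LatticeInstance.intVecToEuclidean_intCoords]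

/-- Reading a batch code placed in front: `readBatchE enc (enc b ++ w) = some (batchToE b)`. [folklore] -/
theorem readBatchE_append {n N : ℕ} {enc : (Fin N → Fin n → ℤ) → List Bool}
    (huniq : ∀ b b' (z : List Bool), enc b <+: z → enc b' <+: z → b = b') (b : Fin N → Fin n → ℤ)
    (w : List Bool) : readBatchE enc (enc b ++ w) = some (batchToE n N b) := by
  rw [readBatchE, readFront_append enc huniq]
  rfl

/-! ### Theorem 3.1: the stage family from its kernel laws -/

section MainTheorem

variable (q : ℕ → ℕ) [∀ n, NeZero (q n)] (α : ℕ → ℝ)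

/-- **The stage hypothesis `hStage` of `thm_3_1_machine_of_stages` from KERNEL-level laws of the stage
family** (Regev 2009, proof of Theorem 3.1 with Lemmas 3.2, 3.3: the chain of `3n` iterative steps is
analysed one stage at a time — bootstrap close to `D_{L,r_{3n}}^{⊗N}`; each iterative step, given the
previous samples, produces samples of the next level up to an error that is negligible on average over
ideal input samples; padding stages copy). The hypothesis keeps the data of `hStage` (`S`, `N`, `mS`,
`encB`, `ν_S`, `θ`, the code properties) and adds a total classical batch reader `readB`; its analytic
clauses are (BOOT) for the kernel at `⟨x, ⟨1⁰, []⟩⟩`, and (FAC), (STEP), (PASS) for the kernels at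
`⟨x, ⟨1ᵏ⁺¹, y⟩⟩`, `y` a possible window output of stage `k` (module docstring). Proof: (BOOT) is the clause for
`chainLaw 1` (`chainLaw_one`); for (STEP) apply `PMF.tvDist_map_bind_le_of_factor` to
`μ = chainLaw (k+1)` (supported on window outputs of stage `k`) with the kernel `κ` on decoded values
induced by (FAC), reference law `D_{L,ρ_k}^{⊗N}` and the bound `E[min 1 F] ≤ ν_S` computed on integer
batches (`idealBatch_eq_map_idealBatchZ`, `PMF.tsum_toReal_map_mul_of_injective`); for (PASS) apply
`PMF.tvDist_map_bind_le_of_pure` with the write-back map `some ∘ batchToE ∘ readB`, under which the ideal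
batch is invariant, the radii `ρ_{k+1} = ρ_k = r` being equal beyond `3n`.
[cite: Regev2009, Theorem 3.1 (proof, p. 15) with Lemmas 3.2, 3.3 and the note after Lemma 3.3] -/
theorem thm_3_1_stage_of_kernelLaws
    (hK : ∀ (m : ℕ → ℕ) (_ : IsPolyBounded m) (_ : IsPolyTimeParams q α m)
      (_ : ∀ᶠ n : ℕ in atTop, 0 < α n ∧ α n < 1 ∧ 2 * Real.sqrt n < α n * q n)
      (_ : ∃ (W : UniformQCircuitFamily) (c : ℝ), 0 < c ∧
        W.SolvesSearchLWEWorstCase q (fun n => discretizedGaussian (q n) (α n)) m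
          fun n => (2 : ℝ) ^ (-(c * n)))
      (ε : ℕ → ℝ), IsNegligible ε → (∀ n, 0 < ε n) →
      ∃ (S : UniformQCircuitFamily) (N : ℕ → ℕ) (mS : Polynomial ℕ)
        (encB : (n : ℕ) → (Fin (N n) → Fin n → ℤ) → List Bool)
        (readB : (n : ℕ) → List Bool → (Fin (N n) → Fin n → ℤ)) (νS : ℕ → ℝ) (θ : ℕ → ℝ),
        IsNegligible νS ∧ (∀ n, 0 < n → α n * q n / Real.sqrt n ≤ θ n) ∧
        (∀ n (b b' : Fin (N n) → Fin n → ℤ) (z : List Bool), encB n b <+: z → encB n b' <+: z → b = b') ∧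
        (∀ n (b : Fin (N n) → Fin n → ℤ) (w : List Bool) (j : Fin (N n)), (j : ℕ) = 0 →
          decodeLatticeVector n (encB n b ++ w) = b j) ∧
        (∀ n, 0 < N n) ∧
        (∀ n (b : Fin (N n) → Fin n → ℤ) (w : List Bool), readB n (encB n b ++ w) = b) ∧
        (∀ n (y : List Bool), (¬ ∃ b, encB n b <+: y) → readB n y = 0) ∧
        ∀ᶠ n : ℕ in atTop, ∀ (I : LatticeInstance) (r : ℚ) (x : List Bool), I.n = n → I.IsNonsingular →
          x = GapSVPInstance.encode (I, r) →
          -- (BOOT) Lemma 3.2 in machine form, at the kernel of stage `0`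
          ((2 : ℝ) ^ (2 * I.n) * successiveMinimum I.lattice I.n < levelRadius (θ I.n) (3 * I.n) r 0 →
            (((S.kernel (stageInput x 0 [])).map fun w => w.takeD (mS.eval x.length) false).map
                (readBatchE (encB I.n))).tvDist
              (idealBatch I (N I.n) (levelRadius (θ I.n) (3 * I.n) r 0)) ≤ νS I.n) ∧
          -- (FAC) the decoded output law depends on the previous window only through the batch read off it
          (∀ (k : ℕ) (y y' : List Bool),
            (∃ y₀ : List Bool, y ∈ ((S.kernel (stageInput x k y₀)).map fun w => w.takeD (mS.eval x.length) false).support) →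
            (∃ y₀ : List Bool, y' ∈ ((S.kernel (stageInput x k y₀)).map fun w => w.takeD (mS.eval x.length) false).support) →
            readB I.n y = readB I.n y' →
            (((S.kernel (stageInput x (k + 1) y)).map fun w => w.takeD (mS.eval x.length) false).map
                (readBatchE (encB I.n))) =
              ((S.kernel (stageInput x (k + 1) y')).map fun w => w.takeD (mS.eval x.length) false).map
                (readBatchE (encB I.n))) ∧
          -- (STEP) Lemma 3.3 in machine form: per-batch error, negligible on average over ideal batches
          (∀ k, k < 3 * I.n →
            Real.sqrt 2 * q I.n * smoothingParameter I.lattice (ε I.n) < levelRadius (θ I.n) (3 * I.n) r k →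
            ∃ F : (Fin (N I.n) → Fin I.n → ℤ) → ℝ, (∀ b, 0 ≤ F b) ∧
              (∀ y : List Bool,
                (∃ y₀ : List Bool, y ∈ ((S.kernel (stageInput x k y₀)).map fun w => w.takeD (mS.eval x.length) false).support) →
                (((S.kernel (stageInput x (k + 1) y)).map fun w => w.takeD (mS.eval x.length) false).map
                    (readBatchE (encB I.n))).tvDist
                  (idealBatch I (N I.n) (levelRadius (θ I.n) (3 * I.n) r (k + 1))) ≤ F (readB I.n y)) ∧
              ∑' b, (idealBatchZ I (N I.n) (levelRadius (θ I.n) (3 * I.n) r k) b).toReal * min 1 (F b) ≤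
                νS I.n) ∧
          -- (PASS) padding stages write the batch back
          (∀ k, 3 * I.n ≤ k → ∀ y : List Bool,
            (∃ y₀ : List Bool, y ∈ ((S.kernel (stageInput x k y₀)).map fun w => w.takeD (mS.eval x.length) false).support) →
            (((S.kernel (stageInput x (k + 1) y)).map fun w => w.takeD (mS.eval x.length) false).map
                (readBatchE (encB I.n))) =
              PMF.pure (some (batchToE I.n (N I.n) (readB I.n y))))) :
    ∀ (m : ℕ → ℕ) (_ : IsPolyBounded m) (_ : IsPolyTimeParams q α m)
      (_ : ∀ᶠ n : ℕ in atTop, 0 < α n ∧ α n < 1 ∧ 2 * Real.sqrt n < α n * q n)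
      (_ : ∃ (W : UniformQCircuitFamily) (c : ℝ), 0 < c ∧
        W.SolvesSearchLWEWorstCase q (fun n => discretizedGaussian (q n) (α n)) m
          fun n => (2 : ℝ) ^ (-(c * n)))
      (ε : ℕ → ℝ), IsNegligible ε → (∀ n, 0 < ε n) →
      ∃ (S : UniformQCircuitFamily) (N : ℕ → ℕ) (mS : Polynomial ℕ)
        (encB : (n : ℕ) → (Fin (N n) → Fin n → ℤ) → List Bool) (νS : ℕ → ℝ) (θ : ℕ → ℝ),
        IsNegligible νS ∧ (∀ n, 0 < n → α n * q n / Real.sqrt n ≤ θ n) ∧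
        (∀ n (b b' : Fin (N n) → Fin n → ℤ) (z : List Bool), encB n b <+: z → encB n b' <+: z → b = b') ∧
        (∀ n (b : Fin (N n) → Fin n → ℤ) (w : List Bool) (j : Fin (N n)), (j : ℕ) = 0 →
          decodeLatticeVector n (encB n b ++ w) = b j) ∧
        (∀ n, 0 < N n) ∧
        ∀ᶠ n : ℕ in atTop, ∀ (I : LatticeInstance) (r : ℚ) (x : List Bool), I.n = n → I.IsNonsingular →
          x = GapSVPInstance.encode (I, r) →
          ((2 : ℝ) ^ (2 * I.n) * successiveMinimum I.lattice I.n < levelRadius (θ I.n) (3 * I.n) r 0 →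
            ((chainLaw 0 S.family (mS.eval x.length) x 1).map (readBatchE (encB I.n))).tvDist
              (idealBatch I (N I.n) (levelRadius (θ I.n) (3 * I.n) r 0)) ≤ νS I.n) ∧
          (∀ k, k < 3 * x.length →
            (k < 3 * I.n → Real.sqrt 2 * q I.n * smoothingParameter I.lattice (ε I.n) <
              levelRadius (θ I.n) (3 * I.n) r k) →
            ((chainLaw 0 S.family (mS.eval x.length) x (k + 2)).map (readBatchE (encB I.n))).tvDist
                (idealBatch I (N I.n) (levelRadius (θ I.n) (3 * I.n) r (k + 1))) ≤
              ((chainLaw 0 S.family (mS.eval x.length) x (k + 1)).map (readBatchE (encB I.n))).tvDist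
                  (idealBatch I (N I.n) (levelRadius (θ I.n) (3 * I.n) r k)) +
                if k < 3 * I.n then νS I.n else 0) := by
  classical
  intro m hm hP hαq hW ε hε hε0
  obtain ⟨S, N, mS, encB, readB, νS, θ, hνS, hθ, hinj, hdec, hN, hread, hread0, hlaw⟩ :=
    hK m hm hP hαq hW ε hε hε0
  refine ⟨S, N, mS, encB, νS, θ, hνS, hθ, hinj, hdec, hN, ?_⟩
  filter_upwards [hlaw] with n hn I r x hIn hI hx
  obtain ⟨hboot, hfac, hstep, hpass⟩ := hn I r x hIn hI hx
  refine ⟨fun h0 => ?_, fun k _ hsm => ?_⟩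
  · rw [chainLaw_one]
    exact hboot h0
  · -- notation
    set win : List Bool → List Bool := fun w => w.takeD (mS.eval x.length) false with hwin
    set readE : List Bool → Option (Fin (N I.n) → EuclideanSpace ℝ (Fin I.n)) := readBatchE (encB I.n)
      with hreadE
    set μ : PMF (List Bool) := chainLaw 0 S.family (mS.eval x.length) x (k + 1) with hμ
    have hsupp : ∀ y ∈ μ.support,
        ∃ y₀ : List Bool, y ∈ ((S.kernel (stageInput x k y₀)).map win).support := by
      intro y hy
      rw [hμ, chainLaw_succ, PMF.mem_support_bind_iff] at hy
      obtain ⟨y₀, -, hy⟩ := hy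
      exact ⟨y₀, hy⟩
    have hsucc : chainLaw 0 S.family (mS.eval x.length) x (k + 2) =
        μ.bind fun y => (S.kernel (stageInput x (k + 1) y)).map win :=
      chainLaw_succ 0 S.family _ x (k + 1)
    -- the embedding of integer batches and its partial inverse on decoded values
    set emb : (Fin (N I.n) → Fin I.n → ℤ) → Option (Fin (N I.n) → EuclideanSpace ℝ (Fin I.n)) :=
      fun b => some (batchToE I.n (N I.n) b) with hemb
    have hembinj : Function.Injective emb := fun b b' h =>
      batchToE_injective _ _ (Option.some_injective _ h)
    let invB : Option (Fin (N I.n) → EuclideanSpace ℝ (Fin I.n)) → (Fin (N I.n) → Fin I.n → ℤ) :=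
      fun o => o.elim 0 (Function.invFun (batchToE I.n (N I.n)))
    have hinvB : ∀ b, invB (emb b) = b := fun b =>
      Function.leftInverse_invFun (batchToE_injective I.n (N I.n)) b
    have hιZ : ∀ k, idealBatch I (N I.n) (levelRadius (θ I.n) (3 * I.n) r k) =
        (idealBatchZ I (N I.n) (levelRadius (θ I.n) (3 * I.n) r k)).map emb := fun k =>
      idealBatch_eq_map_idealBatchZ I (N I.n) _
    -- the reader and the decoder agree
    have hrb : ∀ y, invB (readE y) = readB I.n y := by
      intro y
      cases h : readFront (encB I.n) y with
      | none =>
        have hno : ¬ ∃ b, encB I.n b <+: y := fun ⟨b, hb⟩ => by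
          rw [readFront_eq_some _ (hinj I.n) hb] at h
          cases h
        rw [hread0 _ _ hno, hreadE, readBatchE, h]
        rfl
      | some b =>
        obtain ⟨w, rfl⟩ := prefix_of_readFront_eq_some _ h
        rw [hread, hreadE, readBatchE, h]
        exact hinvB b
    by_cases hk3 : k < 3 * I.n
    · -- (STEP) a quantum stage
      rw [if_pos hk3]
      obtain ⟨F, hF0, hF, hEF⟩ := hstep k hk3 (hsm hk3)
      -- the kernel on decoded values
      let κ : Option (Fin (N I.n) → EuclideanSpace ℝ (Fin I.n)) →
          PMF (Option (Fin (N I.n) → EuclideanSpace ℝ (Fin I.n))) := fun o =>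
        if h : ∃ y : List Bool, (∃ y₀ : List Bool, y ∈ ((S.kernel (stageInput x k y₀)).map win).support) ∧
            readE y = o then
          ((S.kernel (stageInput x (k + 1) (Classical.choose h))).map win).map readE
        else idealBatch I (N I.n) (levelRadius (θ I.n) (3 * I.n) r (k + 1))
      have hκ : ∀ y ∈ μ.support, ((S.kernel (stageInput x (k + 1) y)).map win).map readE = κ (readE y) := by
        intro y hy
        have hlen := hsupp y hy
        have hex : ∃ y' : List Bool, (∃ y₀ : List Bool, y' ∈ ((S.kernel (stageInput x k y₀)).map win).support) ∧
            readE y' = readE y := ⟨y, hlen, rfl⟩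
        simp only [κ, dif_pos hex]
        obtain ⟨hlen', hre⟩ := Classical.choose_spec hex
        refine hfac k y _ hlen hlen' ?_
        rw [← hrb, ← hrb, hre]
      have hκb : ∀ b, (κ (emb b)).tvDist (idealBatch I (N I.n) (levelRadius (θ I.n) (3 * I.n) r (k + 1))) ≤
          min 1 (F b) := by
        intro b
        by_cases hex : ∃ y' : List Bool,
            (∃ y₀ : List Bool, y' ∈ ((S.kernel (stageInput x k y₀)).map win).support) ∧ readE y' = emb b
        · simp only [κ, dif_pos hex]
          obtain ⟨hlen', hre⟩ := Classical.choose_spec hex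
          refine le_min (PMF.tvDist_le_one_holds _ _) ?_
          have h := hF _ hlen'
          rwa [← hrb, hre, hinvB] at h
        · simp only [κ, dif_neg hex, PMF.tvDist_self]
          exact le_min zero_le_one (hF0 b)
      have hsum1 : Summable fun b => (idealBatchZ I (N I.n) (levelRadius (θ I.n) (3 * I.n) r k) b).toReal *
          (κ (emb b)).tvDist (idealBatch I (N I.n) (levelRadius (θ I.n) (3 * I.n) r (k + 1))) :=
        PMF.summable_toReal_mul_of_abs_le_one _ fun b => by
          rw [abs_of_nonneg (PMF.tvDist_nonneg _ _)]
          exact PMF.tvDist_le_one_holds _ _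
      have hsum2 : Summable fun b => (idealBatchZ I (N I.n) (levelRadius (θ I.n) (3 * I.n) r k) b).toReal *
          min 1 (F b) :=
        PMF.summable_toReal_mul_of_abs_le_one _ fun b => by
          rw [abs_of_nonneg (le_min zero_le_one (hF0 b))]
          exact min_le_left _ _
      rw [hsucc]
      refine (PMF.tvDist_map_bind_le_of_factor μ _ readE κ hκ
        (idealBatch I (N I.n) (levelRadius (θ I.n) (3 * I.n) r k)) _).trans (add_le_add le_rfl ?_)
      rw [hιZ k, PMF.tsum_toReal_map_mul_of_injective _ hembinj]
      exact (hsum1.tsum_le_tsum (fun b => mul_le_mul_of_nonneg_left (hκb b) ENNReal.toReal_nonneg) hsum2).trans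
        hEF
    · -- (PASS) a padding stage
      rw [if_neg hk3, add_zero]
      have h3k : 3 * I.n ≤ k := not_lt.1 hk3
      have hρ : levelRadius (θ I.n) (3 * I.n) r (k + 1) = levelRadius (θ I.n) (3 * I.n) r k := by
        simp only [levelRadius, Nat.sub_eq_zero_of_le h3k, Nat.sub_eq_zero_of_le (h3k.trans (Nat.le_succ k))]
      rw [hρ, hsucc]
      refine PMF.tvDist_map_bind_le_of_pure μ _ readE (fun o => emb (invB o)) (fun y hy => ?_) _ ?_
      · rw [hpass k h3k y (hsupp y hy), hrb]
      · rw [hιZ k, PMF.map_comp]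
        refine congrArg (PMF.map · _) (funext fun b => ?_)
        simp only [Function.comp_apply, hinvB]

/-- **Regev 2009, Theorem 3.1 in machine form (`h₂`) from the kernel laws of a stage family**:
`thm_3_1_machine_of_stage ∘ thm_3_1_stage_of_kernelLaws`. [cite: Regev2009, Theorem 3.1 (proof, p. 15)] -/
theorem thm_3_1_machine_of_kernelLaws
    (hK : ∀ (m : ℕ → ℕ) (_ : IsPolyBounded m) (_ : IsPolyTimeParams q α m)
      (_ : ∀ᶠ n : ℕ in atTop, 0 < α n ∧ α n < 1 ∧ 2 * Real.sqrt n < α n * q n)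
      (_ : ∃ (W : UniformQCircuitFamily) (c : ℝ), 0 < c ∧
        W.SolvesSearchLWEWorstCase q (fun n => discretizedGaussian (q n) (α n)) m
          fun n => (2 : ℝ) ^ (-(c * n)))
      (ε : ℕ → ℝ), IsNegligible ε → (∀ n, 0 < ε n) →
      ∃ (S : UniformQCircuitFamily) (N : ℕ → ℕ) (mS : Polynomial ℕ)
        (encB : (n : ℕ) → (Fin (N n) → Fin n → ℤ) → List Bool)
        (readB : (n : ℕ) → List Bool → (Fin (N n) → Fin n → ℤ)) (νS : ℕ → ℝ) (θ : ℕ → ℝ),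
        IsNegligible νS ∧ (∀ n, 0 < n → α n * q n / Real.sqrt n ≤ θ n) ∧
        (∀ n (b b' : Fin (N n) → Fin n → ℤ) (z : List Bool), encB n b <+: z → encB n b' <+: z → b = b') ∧
        (∀ n (b : Fin (N n) → Fin n → ℤ) (w : List Bool) (j : Fin (N n)), (j : ℕ) = 0 →
          decodeLatticeVector n (encB n b ++ w) = b j) ∧
        (∀ n, 0 < N n) ∧
        (∀ n (b : Fin (N n) → Fin n → ℤ) (w : List Bool), readB n (encB n b ++ w) = b) ∧
        (∀ n (y : List Bool), (¬ ∃ b, encB n b <+: y) → readB n y = 0) ∧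
        ∀ᶠ n : ℕ in atTop, ∀ (I : LatticeInstance) (r : ℚ) (x : List Bool), I.n = n → I.IsNonsingular →
          x = GapSVPInstance.encode (I, r) →
          -- (BOOT) Lemma 3.2 in machine form, at the kernel of stage `0`
          ((2 : ℝ) ^ (2 * I.n) * successiveMinimum I.lattice I.n < levelRadius (θ I.n) (3 * I.n) r 0 →
            (((S.kernel (stageInput x 0 [])).map fun w => w.takeD (mS.eval x.length) false).map
                (readBatchE (encB I.n))).tvDist
              (idealBatch I (N I.n) (levelRadius (θ I.n) (3 * I.n) r 0)) ≤ νS I.n) ∧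
          -- (FAC) the decoded output law depends on the previous window only through the batch read off it
          (∀ (k : ℕ) (y y' : List Bool),
            (∃ y₀ : List Bool, y ∈ ((S.kernel (stageInput x k y₀)).map fun w => w.takeD (mS.eval x.length) false).support) →
            (∃ y₀ : List Bool, y' ∈ ((S.kernel (stageInput x k y₀)).map fun w => w.takeD (mS.eval x.length) false).support) →
            readB I.n y = readB I.n y' →
            (((S.kernel (stageInput x (k + 1) y)).map fun w => w.takeD (mS.eval x.length) false).map
                (readBatchE (encB I.n))) =
              ((S.kernel (stageInput x (k + 1) y')).map fun w => w.takeD (mS.eval x.length) false).map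
                (readBatchE (encB I.n))) ∧
          -- (STEP) Lemma 3.3 in machine form: per-batch error, negligible on average over ideal batches
          (∀ k, k < 3 * I.n →
            Real.sqrt 2 * q I.n * smoothingParameter I.lattice (ε I.n) < levelRadius (θ I.n) (3 * I.n) r k →
            ∃ F : (Fin (N I.n) → Fin I.n → ℤ) → ℝ, (∀ b, 0 ≤ F b) ∧
              (∀ y : List Bool,
                (∃ y₀ : List Bool, y ∈ ((S.kernel (stageInput x k y₀)).map fun w => w.takeD (mS.eval x.length) false).support) →
                (((S.kernel (stageInput x (k + 1) y)).map fun w => w.takeD (mS.eval x.length) false).map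
                    (readBatchE (encB I.n))).tvDist
                  (idealBatch I (N I.n) (levelRadius (θ I.n) (3 * I.n) r (k + 1))) ≤ F (readB I.n y)) ∧
              ∑' b, (idealBatchZ I (N I.n) (levelRadius (θ I.n) (3 * I.n) r k) b).toReal * min 1 (F b) ≤
                νS I.n) ∧
          -- (PASS) padding stages write the batch back
          (∀ k, 3 * I.n ≤ k → ∀ y : List Bool,
            (∃ y₀ : List Bool, y ∈ ((S.kernel (stageInput x k y₀)).map fun w => w.takeD (mS.eval x.length) false).support) →
            (((S.kernel (stageInput x (k + 1) y)).map fun w => w.takeD (mS.eval x.length) false).map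
                (readBatchE (encB I.n))) =
              PMF.pure (some (batchToE I.n (N I.n) (readB I.n y))))) :
    ∀ (m : ℕ → ℕ) (_ : IsPolyBounded m) (_ : IsPolyTimeParams q α m)
      (_ : ∀ᶠ n : ℕ in atTop, 0 < α n ∧ α n < 1 ∧ 2 * Real.sqrt n < α n * q n)
      (_ : ∃ (W : UniformQCircuitFamily) (c : ℝ), 0 < c ∧
        W.SolvesSearchLWEWorstCase q (fun n => discretizedGaussian (q n) (α n)) m
          fun n => (2 : ℝ) ^ (-(c * n)))
      (ε : ℕ → ℝ), IsNegligible ε → (∀ n, 0 < ε n) →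
      ∃ (D : UniformQCircuitFamily) (ν : ℕ → ℝ), IsNegligible ν ∧ D.SamplesDGS (regevDGSBound α ε) ν :=
  thm_3_1_machine_of_stage q α (thm_3_1_stage_of_kernelLaws q α hK)

end MainTheorem

end Regev2009

/-! ### pqc.S19 (SIVP form) from the kernel laws of a stage family -/

section Corollary

variable (q : ℕ → ℕ) [∀ n, NeZero (q n)] (α : ℕ → ℝ) (m : ℕ → ℕ)

/-- **pqc.S19 (SIVP form) rests on the kernel laws of one stage family** (with `h₁` =
`Regev2009.searchLWE_worstCase_of_avgCase`, `hLoop` = `ChainCompose.exists_chainFamily`, `h₃` =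
`Regev2009.GIVPMachine.regev_dgs_to_givp_quantum`, Lemma 3.17 = `DGSToSIVP*`, all theorems):
`regev_lwe_to_sivp_quantum_of_stage ∘ Regev2009.thm_3_1_stage_of_kernelLaws`. The GapSVP form follows in
the same way from `regev_lwe_to_gapSVP_quantum_of_stage_of_lemma320`.
[cite: Regev2009, Thm 1.1 from Thm 3.1 (proof, p. 15) and Lemma 3.17] -/
theorem regev_lwe_to_sivp_quantum_of_kernelLaws
    (hK : ∀ (m : ℕ → ℕ) (_ : IsPolyBounded m) (_ : IsPolyTimeParams q α m)
      (_ : ∀ᶠ n : ℕ in atTop, 0 < α n ∧ α n < 1 ∧ 2 * Real.sqrt n < α n * q n)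
      (_ : ∃ (W : UniformQCircuitFamily) (c : ℝ), 0 < c ∧
        W.SolvesSearchLWEWorstCase q (fun n => discretizedGaussian (q n) (α n)) m
          fun n => (2 : ℝ) ^ (-(c * n)))
      (ε : ℕ → ℝ), IsNegligible ε → (∀ n, 0 < ε n) →
      ∃ (S : UniformQCircuitFamily) (N : ℕ → ℕ) (mS : Polynomial ℕ)
        (encB : (n : ℕ) → (Fin (N n) → Fin n → ℤ) → List Bool)
        (readB : (n : ℕ) → List Bool → (Fin (N n) → Fin n → ℤ)) (νS : ℕ → ℝ) (θ : ℕ → ℝ),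
        IsNegligible νS ∧ (∀ n, 0 < n → α n * q n / Real.sqrt n ≤ θ n) ∧
        (∀ n (b b' : Fin (N n) → Fin n → ℤ) (z : List Bool), encB n b <+: z → encB n b' <+: z → b = b') ∧
        (∀ n (b : Fin (N n) → Fin n → ℤ) (w : List Bool) (j : Fin (N n)), (j : ℕ) = 0 →
          decodeLatticeVector n (encB n b ++ w) = b j) ∧
        (∀ n, 0 < N n) ∧
        (∀ n (b : Fin (N n) → Fin n → ℤ) (w : List Bool), readB n (encB n b ++ w) = b) ∧
        (∀ n (y : List Bool), (¬ ∃ b, encB n b <+: y) → readB n y = 0) ∧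
        ∀ᶠ n : ℕ in atTop, ∀ (I : LatticeInstance) (r : ℚ) (x : List Bool), I.n = n → I.IsNonsingular →
          x = GapSVPInstance.encode (I, r) →
          -- (BOOT) Lemma 3.2 in machine form, at the kernel of stage `0`
          ((2 : ℝ) ^ (2 * I.n) * successiveMinimum I.lattice I.n < Regev2009.levelRadius (θ I.n) (3 * I.n) r 0 →
            (((S.kernel (stageInput x 0 [])).map fun w => w.takeD (mS.eval x.length) false).map
                (Regev2009.readBatchE (encB I.n))).tvDist
              (Regev2009.idealBatch I (N I.n) (Regev2009.levelRadius (θ I.n) (3 * I.n) r 0)) ≤ νS I.n) ∧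
          -- (FAC) the decoded output law depends on the previous window only through the batch read off it
          (∀ (k : ℕ) (y y' : List Bool),
            (∃ y₀ : List Bool, y ∈ ((S.kernel (stageInput x k y₀)).map fun w => w.takeD (mS.eval x.length) false).support) →
            (∃ y₀ : List Bool, y' ∈ ((S.kernel (stageInput x k y₀)).map fun w => w.takeD (mS.eval x.length) false).support) →
            readB I.n y = readB I.n y' →
            (((S.kernel (stageInput x (k + 1) y)).map fun w => w.takeD (mS.eval x.length) false).map
                (Regev2009.readBatchE (encB I.n))) =
              ((S.kernel (stageInput x (k + 1) y')).map fun w => w.takeD (mS.eval x.length) false).map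
                (Regev2009.readBatchE (encB I.n))) ∧
          -- (STEP) Lemma 3.3 in machine form: per-batch error, negligible on average over ideal batches
          (∀ k, k < 3 * I.n →
            Real.sqrt 2 * q I.n * smoothingParameter I.lattice (ε I.n) < Regev2009.levelRadius (θ I.n) (3 * I.n) r k →
            ∃ F : (Fin (N I.n) → Fin I.n → ℤ) → ℝ, (∀ b, 0 ≤ F b) ∧
              (∀ y : List Bool,
                (∃ y₀ : List Bool, y ∈ ((S.kernel (stageInput x k y₀)).map fun w => w.takeD (mS.eval x.length) false).support) →
                (((S.kernel (stageInput x (k + 1) y)).map fun w => w.takeD (mS.eval x.length) false).map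
                    (Regev2009.readBatchE (encB I.n))).tvDist
                  (Regev2009.idealBatch I (N I.n) (Regev2009.levelRadius (θ I.n) (3 * I.n) r (k + 1))) ≤ F (readB I.n y)) ∧
              ∑' b, (Regev2009.idealBatchZ I (N I.n) (Regev2009.levelRadius (θ I.n) (3 * I.n) r k) b).toReal * min 1 (F b) ≤
                νS I.n) ∧
          -- (PASS) padding stages write the batch back
          (∀ k, 3 * I.n ≤ k → ∀ y : List Bool,
            (∃ y₀ : List Bool, y ∈ ((S.kernel (stageInput x k y₀)).map fun w => w.takeD (mS.eval x.length) false).support) →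
            (((S.kernel (stageInput x (k + 1) y)).map fun w => w.takeD (mS.eval x.length) false).map
                (Regev2009.readBatchE (encB I.n))) =
              PMF.pure (some (Regev2009.batchToE I.n (N I.n) (readB I.n y))))) :
    regev_lwe_to_sivp_quantum q α m :=
  regev_lwe_to_sivp_quantum_of_stage q α m (Regev2009.thm_3_1_stage_of_kernelLaws q α hK)

end Corollary

end Literature.Computability.Cryptography

end
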